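import Literature.RingTheory.HilbertSamuel.HilbertFunctions
import Literature.RingTheory.HilbertSamuel.RegularLocalRing
import Mathlib.RingTheory.MvPolynomial.Homogeneous
import Mathlib.LinearAlgebra.Dimension.Finrank
import Mathlib.LinearAlgebra.Finsupp.VectorSpace
import Mathlib.LinearAlgebra.Dimension.Constructions
import HarnessLib

/-!
# `Φ^{(t)}` is the Hilbert function of the polynomial ring `k[X_1, …, X_t]`
# (Cossart–Jannsen–Saito 2020, Def. 2.13)

Topic: `Literature/RingTheory/HilbertSamuel`. CJS, LNM 2270, Def. 2.13: "Define `Φ^{(t)}` … Then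
one has `Φ^{(t)}(n) = H^{(0)}(k[X_1, …, X_t])(n) = binom(n+t-1, n)` for all `n ≥ 0`", where for a
finitely generated graded `k`-algebra `A` "its Hilbert function is … `H(A)(n) = dim_k(A_n)`"
(Def. 2.11). The identity `Φ^{(t)}(n) = binom(n+t-1, n)` is `iterPSum_Phi_eq_choose`
(`HilbertFunctions.lean`); here we PROVE the other equality, for the standard grading of
Mathlib's `MvPolynomial (Fin t) k` (`homogeneousSubmodule`):

* `finrank_homogeneousSubmodule_fin` — `dim_k k[X_1, …, X_t]_n = binom(n+t-1, n)` (the monomials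
  of degree `n` form a basis; counted by stars and bars, `card_monomialsOfDegree`);
* `iterPSum_Phi_eq_finrank_homogeneousSubmodule` — `Φ^{(t)}(n) = dim_k k[X_1, …, X_t]_n`.

## Sources

* V. Cossart, U. Jannsen, S. Saito, LNM 2270 (2020), Def. 2.11, Def. 2.13. [CossartJannsenSaito2020]
-/

noncomputable section

open MvPolynomial

namespace Literature.RingTheory.HilbertSamuel

universe u

variable (k : Type u) [Field k]

/-- **`dim_k k[X_1, …, X_t]_n = binom(n + t - 1, n)`**: the forms of degree `n` in `t` variables
have the monomials of degree `n` as a basis (`homogeneousSubmodule_eq_finsupp_supported`), and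
there are `binom(t + n - 1, n)` of them (`card_monomialsOfDegree`). [folklore] -/
theorem finrank_homogeneousSubmodule_fin (t n : ℕ) :
    Module.finrank k (homogeneousSubmodule (Fin t) k n) = (n + t - 1).choose n := by
  classical
  have e1 : (homogeneousSubmodule (Fin t) k n : Submodule k (MvPolynomial (Fin t) k)) =
      AddMonoidAlgebra.supported k k {m : Fin t →₀ ℕ | m.degree = n} :=
    homogeneousSubmodule_eq_finsupp_supported (Fin t) k n
  let e : homogeneousSubmodule (Fin t) k n ≃ₗ[k] (monomialsOfDegree t n →₀ k) :=
    (LinearEquiv.ofEq _ _ e1).trans (AddMonoidAlgebra.supportedEquivFinsupp _)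
  letI : Fintype (monomialsOfDegree t n) := Fintype.ofFinite _
  rw [e.finrank_eq, (Finsupp.linearEquivFunOnFinite k k _).finrank_eq,
    Module.finrank_fintype_fun_eq_card, ← Nat.card_eq_fintype_card, card_monomialsOfDegree,
    Nat.add_comm t n]

/-- **CJS Def. 2.13: `Φ^{(t)}(n) = H^{(0)}(k[X_1, …, X_t])(n)`** — `Φ^{(t)}` is the Hilbert function
of the polynomial ring in `t` variables with its standard grading.
[cite: CossartJannsenSaito2020, Def. 2.13] -/
theorem iterPSum_Phi_eq_finrank_homogeneousSubmodule (t n : ℕ) :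
    iterPSum t Phi n = Module.finrank k (homogeneousSubmodule (Fin t) k n) := by
  rw [finrank_homogeneousSubmodule_fin, iterPSum_Phi_eq_choose]

end Literature.RingTheory.HilbertSamuel

end
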